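import Summits.AtomisticToContinuum.Crystallization.Theses.ReggeStarCoercivity
import Summits.AtomisticToContinuum.Crystallization.Theses.PalmUnimodularRigidity
import Summits.AtomisticToContinuum.Crystallization.Theorems.ReggeStarCoercivityDefectFreeCrystallizesRouteBeta
import Summits.AtomisticToContinuum.Crystallization.Theorems.ReggeStarCoercivityDefectFreeCrystallizesPalmDefs
import Literature.Probability.Process.PointStationaryLaw
import Literature.MathematicalPhysics.StatisticalMechanics.BarlowStacking

/-!
# Line `scale-first` for crux `ReggeStarCoercivity.DefectFreeCrystallizes` (item stmt-AtomisticToContinuum-13603)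
# — ALTERNATIVE skeleton registered by the crux-strategist (gen 1, 2026-08-17); it does NOT replace the lead's
# `Lines/palm_good_law.lean` (v16), whose landed pieces it reuses BY NAME.

State of the crux (lead c5, kernel-checked as `Theorems/…RouteBeta.lean`, p134404): the crux is CLOSED MODULO
R2a′ `ChartedFunnelToShells` (charted `5 %` funnel law ⇒ `1 %` shells, the lead's registered conjecture-class stub)
and crux 9226 `LayeredLawsSelectHcp`.  This line CUTS R2a′ along the one seam whose two sides need different
mathematics:

* S1 `stub_bondWindowPinning` (L; certificate-FREE, margins `≥ 5·10⁻³`): a minimising charted funnel law has,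
  almost surely, EVERY bond length (pairs at distance in `(0, 6/5)`) in the window `[93/100, 101/100]` — the gross
  elastic excess of scale drift (relaxed hcp/fcc bonds `0.9713…`; uniform scale `0.94 / 1.01` costs `≥ 3·10⁻²`,
  one bond pushed to the window edge `≈ ½·V″(a₀)·(0.04)² ≈ 8·10⁻³`), proved at the LAW level with antisymmetric
  tail re-assignment correctors of zero Mecke mean (per-site energies are NOT bounded below by `e*` on the tube: a
  dilated `13`-atom core in a `7 %`-compressed matrix has root energy `≈ −0.80 < e* ≈ −0.7176`, so S1 is not a
  sitewise inequality — but its margin is `10⁻²`, two orders above every certificate-bound quantity of this crux);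
* S2 `stub_shapeExactificationPinned` (XL; the certificate-class core, = R2a′ GIVEN the bond window): with all bonds
  in `[0.93, 1.01]` the scale degree of freedom is gone and the local configuration space is a compact annulus
  around the relaxed stars; what remains is the word-wise secant coercivity `E_P[h] ≥ e(relaxed same-word stacking)
  + c·P(root shell not 1 %-good)` (cheapest `1 %`-bad mode `≈ 1.3·10⁻⁴`/site, C44 shear; 9226-c1's frame-free second
  variation in the squared bond lengths + 9226-c2's Mecke correctors + a 9333-type PSD certificate uniform over the
  local stacking environments; tangent convexity fails beyond `≈ 2.5 %` inner mis-shift, kit j017763, so secant form);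
* S3 `stub_layeredLawsSelectHcp` = crux 9226 BY NAME (shared, own lead).

Composition (no `sorry` outside the three stubs): `chartedFunnelToShells_of_pinning : S1 → S2 → R2a′` (pure logic) and
`DefectFreeCrystallizes_of : S1 → S2 → S3 → crux` through the LANDED `RouteBeta.defectFreeCrystallizes_of_chartedFunnelToShells`
(P1 p118889, R1 funnel chart p133847, 9227, R3 p125326, 2916, `LennardJonesMinimalDistance_holds`).

Disproof obligations honoured: every stub keeps the energy hypothesis `E_P[h] ≤ e*` (the crux is FALSE without ground
states — Disproof §8 `WithoutGroundStates.not_defectFreeCrystallizesWithoutGroundStates`, ruler Hägg word — and 9226 is false without energy, 9226 Disproof); the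
intended equality case, the relaxed-hcp Palm law, satisfies S1's window (bonds `0.9713`, certified box
`a₀ ∈ [0.945, 0.995]`, `√(a₀²/3 + h₀²) ≤ 0.997 < 1.01`) and S2's conclusion (distortion `1e-4·a ≪ a/100`, `a₀ ≤ 1`).
-/

noncomputable section

open scoped BigOperators ENNReal
open Filter Topology MeasureTheory

namespace Summit.AtomisticToContinuum.Crystallization.Cruxes.DefectFreeCrystallizes.ScaleFirst

open Summit.AtomisticToContinuum.Crystallization.Theses
open Summit.AtomisticToContinuum.Crystallization.Theorems.PalmGoodLaw (SetGood)
open Literature.MathematicalPhysics.StatisticalMechanics Literature.Geometry.DiscreteGeometry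
open Literature.Probability.Process

/-! ## Registered stubs (the only sorries of the file) -/

/-- **S1 `stub_bondWindowPinning` (size L; certificate-free; THE NEW STUB OF THIS LINE).**  BOND-WINDOW PINNING OF
MINIMISING CHARTED FUNNEL LAWS: a minimising (`E_P[h] ≤ e*`) point-stationary `δ`-hard-core probability law almost surely
carried by everywhere-`SetGood`, Barlow-bond-isomorphic configurations is almost surely carried by configurations ALL of
whose bonds (pairs at distance in `(0, 6/5)`) have length in `[93/100, 101/100]`.  Why plausibly true: the relaxed
Barlow stackings have bonds `0.9713 ± 1e-4`; a bond at the window edge forces a local elastic excess `≳ 8e-3`, uniform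
scale drift to `0.94 / 1.01` costs `≥ 3e-2` (9226 NOTES §6a(δ)), against a total stacking-energy spread `≤ 1e-4`.
Mechanism: law-level inequality `E_P[h] ≥ e* + c·P(root has an out-of-window bond)` by a first-shell/tail split of the
root energy, the tail re-assigned between the two ends of each far pair by an antisymmetric rule (zero mean under the
Mecke identity, `IsPointStationaryLaw`), convexity of the one-variable gross scale function, and `e* ≤ e(Q)` for the
periodic comparison configurations (`eStar_le`).  NOT a sitewise bound (dilated core in a compressed matrix: root energy
`−0.80 < e*`). -/
theorem stub_bondWindowPinning :
    ∀ δ : ℝ, 0 < δ → ∀ P : Measure (Measure (EuclideanSpace ℝ (Fin 3))), IsProbabilityMeasure P →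
      (∀ᵐ μ ∂P, IsRootedHardCore δ μ) → IsPointStationaryLaw P →
      (∫ μ, (∫ y, lennardJones ‖y‖ ∂μ) / 2 ∂P) ≤
        (⨅ Q : PeriodicConfiguration 3, Q.energyPerParticle lennardJones) →
      (∀ᵐ μ ∂P, ∃ S : Set (EuclideanSpace ℝ (Fin 3)),
        μ = (Measure.count : Measure (EuclideanSpace ℝ (Fin 3))).restrict S ∧
        (∀ y ∈ S, SetGood S y) ∧
        ∃ s : ℤ → ℤ, IsHaggSeq s ∧
          ∃ Φ : EuclideanSpace ℝ (Fin 3) → EuclideanSpace ℝ (Fin 3),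
            Set.BijOn Φ (barlowStacking 1 (Real.sqrt (2 / 3)) s) S ∧
            ∀ p ∈ barlowStacking 1 (Real.sqrt (2 / 3)) s, ∀ q ∈ barlowStacking 1 (Real.sqrt (2 / 3)) s,
              (dist p q = 1 ↔ (0 < dist (Φ p) (Φ q) ∧ dist (Φ p) (Φ q) < 6 / 5))) →
      ∀ᵐ μ ∂P, ∃ S : Set (EuclideanSpace ℝ (Fin 3)),
        μ = (Measure.count : Measure (EuclideanSpace ℝ (Fin 3))).restrict S ∧
        ∀ x ∈ S, ∀ y ∈ S, 0 < dist x y → dist x y < 6 / 5 →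
          (93 / 100 : ℝ) ≤ dist x y ∧ dist x y ≤ 101 / 100 := by
  sorry

/-- **S2 `stub_shapeExactificationPinned` (size XL; certificate-class; THE HARDEST STUB).**  SHAPE EXACTIFICATION AT
PINNED SCALE: a minimising charted funnel law (as in S1) that is, in addition, almost surely carried by configurations
all of whose bonds lie in `[93/100, 101/100]` is almost surely carried by configurations every point of which has an
`(a/100)`-close-packed shell at a scale `a ∈ [9/10, 1]` read in the closed `5a/4`-ball (R2a′'s conclusion verbatim =
the shell clause of crux 9226's hypothesis).  Content: word-wise secant coercivity on the compact annulus
`{bonds ∈ [0.93, 1.01], shells 1/20-good} ∖ {shells 1 %-good}` relative to the relaxed stacking of the configuration's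
own Hägg word (law energy `≥ e*` by `eStar_le` / 9229, so no stacking selection), by the frame-free second variation
in the squared bond lengths (stationarity + Burgers closure kill the first order, zero stress the affine part; landed
for hcp: `affinePrestress_vanishes`, `sublatticeForce_vanishes`), Mecke correctors (`tube_corrector_mean_zero`) and a
9333-type PSD certificate uniform over the local stacking environments; cheapest `1 %`-bad mode `≈ 1.3e-4`/site. -/
theorem stub_shapeExactificationPinned :
    ∀ δ : ℝ, 0 < δ → ∀ P : Measure (Measure (EuclideanSpace ℝ (Fin 3))), IsProbabilityMeasure P →
      (∀ᵐ μ ∂P, IsRootedHardCore δ μ) → IsPointStationaryLaw P →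
      (∫ μ, (∫ y, lennardJones ‖y‖ ∂μ) / 2 ∂P) ≤
        (⨅ Q : PeriodicConfiguration 3, Q.energyPerParticle lennardJones) →
      (∀ᵐ μ ∂P, ∃ S : Set (EuclideanSpace ℝ (Fin 3)),
        μ = (Measure.count : Measure (EuclideanSpace ℝ (Fin 3))).restrict S ∧
        (∀ y ∈ S, SetGood S y) ∧
        ∃ s : ℤ → ℤ, IsHaggSeq s ∧
          ∃ Φ : EuclideanSpace ℝ (Fin 3) → EuclideanSpace ℝ (Fin 3),
            Set.BijOn Φ (barlowStacking 1 (Real.sqrt (2 / 3)) s) S ∧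
            ∀ p ∈ barlowStacking 1 (Real.sqrt (2 / 3)) s, ∀ q ∈ barlowStacking 1 (Real.sqrt (2 / 3)) s,
              (dist p q = 1 ↔ (0 < dist (Φ p) (Φ q) ∧ dist (Φ p) (Φ q) < 6 / 5))) →
      (∀ᵐ μ ∂P, ∃ S : Set (EuclideanSpace ℝ (Fin 3)),
        μ = (Measure.count : Measure (EuclideanSpace ℝ (Fin 3))).restrict S ∧
        ∀ x ∈ S, ∀ y ∈ S, 0 < dist x y → dist x y < 6 / 5 →
          (93 / 100 : ℝ) ≤ dist x y ∧ dist x y ≤ 101 / 100) →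
      ∀ᵐ μ ∂P, ∃ S : Set (EuclideanSpace ℝ (Fin 3)),
        μ = (Measure.count : Measure (EuclideanSpace ℝ (Fin 3))).restrict S ∧
        ∀ x ∈ S, (∃ a : ℝ, 9 / 10 ≤ a ∧ a ≤ 1 ∧ ∃ T : Finset (EuclideanSpace ℝ (Fin 3)),
          (↑T : Set (EuclideanSpace ℝ (Fin 3))) =
            (fun y : EuclideanSpace ℝ (Fin 3) => y - x) ''
              {y : EuclideanSpace ℝ (Fin 3) | y ∈ S ∧ y ≠ x ∧ dist y x ≤ 5 / 4 * a} ∧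
          (ShellCloseTo (a / 100) T (Finset.image (fun v : EuclideanSpace ℝ (Fin 3) => a • v) fccKissingPattern) ∨
            ShellCloseTo (a / 100) T (Finset.image (fun v : EuclideanSpace ℝ (Fin 3) => a • v) hcpKissingPattern))) := by
  sorry

/-- **S3 = crux stmt-AtomisticToContinuum-9226 BY NAME** (shared with route `PalmUnimodularRigidity`; own lead, closed
modulo its e*-free cores `stub_selectionFloor`, `stub_hcpTubeRigidity`). -/
theorem stub_layeredLawsSelectHcp : PalmUnimodularRigidity.LayeredLawsSelectHcp := by
  sorry

/-! ## The kernel-checked composition -/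

/-- **R2a′ from S1 and S2** (pure logic: feed S1's almost-sure bond window into S2).  The conclusion is VERBATIM the
lead's registered stub `stub_chartedFunnelToShells` / the hypothesis `hR2a` of the landed
`RouteBeta.defectFreeCrystallizes_of_chartedFunnelToShells`. -/
theorem chartedFunnelToShells_of_pinning
    (h₁ :
    ∀ δ : ℝ, 0 < δ → ∀ P : Measure (Measure (EuclideanSpace ℝ (Fin 3))), IsProbabilityMeasure P →
      (∀ᵐ μ ∂P, IsRootedHardCore δ μ) → IsPointStationaryLaw P →
      (∫ μ, (∫ y, lennardJones ‖y‖ ∂μ) / 2 ∂P) ≤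
        (⨅ Q : PeriodicConfiguration 3, Q.energyPerParticle lennardJones) →
      (∀ᵐ μ ∂P, ∃ S : Set (EuclideanSpace ℝ (Fin 3)),
        μ = (Measure.count : Measure (EuclideanSpace ℝ (Fin 3))).restrict S ∧
        (∀ y ∈ S, SetGood S y) ∧
        ∃ s : ℤ → ℤ, IsHaggSeq s ∧
          ∃ Φ : EuclideanSpace ℝ (Fin 3) → EuclideanSpace ℝ (Fin 3),
            Set.BijOn Φ (barlowStacking 1 (Real.sqrt (2 / 3)) s) S ∧
            ∀ p ∈ barlowStacking 1 (Real.sqrt (2 / 3)) s, ∀ q ∈ barlowStacking 1 (Real.sqrt (2 / 3)) s,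
              (dist p q = 1 ↔ (0 < dist (Φ p) (Φ q) ∧ dist (Φ p) (Φ q) < 6 / 5))) →
      ∀ᵐ μ ∂P, ∃ S : Set (EuclideanSpace ℝ (Fin 3)),
        μ = (Measure.count : Measure (EuclideanSpace ℝ (Fin 3))).restrict S ∧
        ∀ x ∈ S, ∀ y ∈ S, 0 < dist x y → dist x y < 6 / 5 →
          (93 / 100 : ℝ) ≤ dist x y ∧ dist x y ≤ 101 / 100)
    (h₂ :
    ∀ δ : ℝ, 0 < δ → ∀ P : Measure (Measure (EuclideanSpace ℝ (Fin 3))), IsProbabilityMeasure P →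
      (∀ᵐ μ ∂P, IsRootedHardCore δ μ) → IsPointStationaryLaw P →
      (∫ μ, (∫ y, lennardJones ‖y‖ ∂μ) / 2 ∂P) ≤
        (⨅ Q : PeriodicConfiguration 3, Q.energyPerParticle lennardJones) →
      (∀ᵐ μ ∂P, ∃ S : Set (EuclideanSpace ℝ (Fin 3)),
        μ = (Measure.count : Measure (EuclideanSpace ℝ (Fin 3))).restrict S ∧
        (∀ y ∈ S, SetGood S y) ∧
        ∃ s : ℤ → ℤ, IsHaggSeq s ∧
          ∃ Φ : EuclideanSpace ℝ (Fin 3) → EuclideanSpace ℝ (Fin 3),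
            Set.BijOn Φ (barlowStacking 1 (Real.sqrt (2 / 3)) s) S ∧
            ∀ p ∈ barlowStacking 1 (Real.sqrt (2 / 3)) s, ∀ q ∈ barlowStacking 1 (Real.sqrt (2 / 3)) s,
              (dist p q = 1 ↔ (0 < dist (Φ p) (Φ q) ∧ dist (Φ p) (Φ q) < 6 / 5))) →
      (∀ᵐ μ ∂P, ∃ S : Set (EuclideanSpace ℝ (Fin 3)),
        μ = (Measure.count : Measure (EuclideanSpace ℝ (Fin 3))).restrict S ∧
        ∀ x ∈ S, ∀ y ∈ S, 0 < dist x y → dist x y < 6 / 5 →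
          (93 / 100 : ℝ) ≤ dist x y ∧ dist x y ≤ 101 / 100) →
      ∀ᵐ μ ∂P, ∃ S : Set (EuclideanSpace ℝ (Fin 3)),
        μ = (Measure.count : Measure (EuclideanSpace ℝ (Fin 3))).restrict S ∧
        ∀ x ∈ S, (∃ a : ℝ, 9 / 10 ≤ a ∧ a ≤ 1 ∧ ∃ T : Finset (EuclideanSpace ℝ (Fin 3)),
          (↑T : Set (EuclideanSpace ℝ (Fin 3))) =
            (fun y : EuclideanSpace ℝ (Fin 3) => y - x) ''
              {y : EuclideanSpace ℝ (Fin 3) | y ∈ S ∧ y ≠ x ∧ dist y x ≤ 5 / 4 * a} ∧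
          (ShellCloseTo (a / 100) T (Finset.image (fun v : EuclideanSpace ℝ (Fin 3) => a • v) fccKissingPattern) ∨
            ShellCloseTo (a / 100) T (Finset.image (fun v : EuclideanSpace ℝ (Fin 3) => a • v) hcpKissingPattern)))) :
    ∀ δ : ℝ, 0 < δ → ∀ P : Measure (Measure (EuclideanSpace ℝ (Fin 3))), IsProbabilityMeasure P →
      (∀ᵐ μ ∂P, IsRootedHardCore δ μ) → IsPointStationaryLaw P →
      (∫ μ, (∫ y, lennardJones ‖y‖ ∂μ) / 2 ∂P) ≤
        (⨅ Q : PeriodicConfiguration 3, Q.energyPerParticle lennardJones) →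
      (∀ᵐ μ ∂P, ∃ S : Set (EuclideanSpace ℝ (Fin 3)),
        μ = (Measure.count : Measure (EuclideanSpace ℝ (Fin 3))).restrict S ∧
        (∀ y ∈ S, SetGood S y) ∧
        ∃ s : ℤ → ℤ, IsHaggSeq s ∧
          ∃ Φ : EuclideanSpace ℝ (Fin 3) → EuclideanSpace ℝ (Fin 3),
            Set.BijOn Φ (barlowStacking 1 (Real.sqrt (2 / 3)) s) S ∧
            ∀ p ∈ barlowStacking 1 (Real.sqrt (2 / 3)) s, ∀ q ∈ barlowStacking 1 (Real.sqrt (2 / 3)) s,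
              (dist p q = 1 ↔ (0 < dist (Φ p) (Φ q) ∧ dist (Φ p) (Φ q) < 6 / 5))) →
      ∀ᵐ μ ∂P, ∃ S : Set (EuclideanSpace ℝ (Fin 3)),
        μ = (Measure.count : Measure (EuclideanSpace ℝ (Fin 3))).restrict S ∧
        ∀ x ∈ S, (∃ a : ℝ, 9 / 10 ≤ a ∧ a ≤ 1 ∧ ∃ T : Finset (EuclideanSpace ℝ (Fin 3)),
          (↑T : Set (EuclideanSpace ℝ (Fin 3))) =
            (fun y : EuclideanSpace ℝ (Fin 3) => y - x) ''
              {y : EuclideanSpace ℝ (Fin 3) | y ∈ S ∧ y ≠ x ∧ dist y x ≤ 5 / 4 * a} ∧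
          (ShellCloseTo (a / 100) T (Finset.image (fun v : EuclideanSpace ℝ (Fin 3) => a • v) fccKissingPattern) ∨
            ShellCloseTo (a / 100) T (Finset.image (fun v : EuclideanSpace ℝ (Fin 3) => a • v) hcpKissingPattern))) :=
  fun δ hδ P hP hcore hstat hE hchart =>
    h₂ δ hδ P hP hcore hstat hE hchart (h₁ δ hδ P hP hcore hstat hE hchart)

/-- **The crux from the three stubs' STATEMENTS** (no stub used, no sorry): S1 → S2 → S3 → `DefectFreeCrystallizes`,
through `chartedFunnelToShells_of_pinning` and the landed route-β composition. -/
theorem DefectFreeCrystallizes_of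
    (h₁ :
    ∀ δ : ℝ, 0 < δ → ∀ P : Measure (Measure (EuclideanSpace ℝ (Fin 3))), IsProbabilityMeasure P →
      (∀ᵐ μ ∂P, IsRootedHardCore δ μ) → IsPointStationaryLaw P →
      (∫ μ, (∫ y, lennardJones ‖y‖ ∂μ) / 2 ∂P) ≤
        (⨅ Q : PeriodicConfiguration 3, Q.energyPerParticle lennardJones) →
      (∀ᵐ μ ∂P, ∃ S : Set (EuclideanSpace ℝ (Fin 3)),
        μ = (Measure.count : Measure (EuclideanSpace ℝ (Fin 3))).restrict S ∧
        (∀ y ∈ S, SetGood S y) ∧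
        ∃ s : ℤ → ℤ, IsHaggSeq s ∧
          ∃ Φ : EuclideanSpace ℝ (Fin 3) → EuclideanSpace ℝ (Fin 3),
            Set.BijOn Φ (barlowStacking 1 (Real.sqrt (2 / 3)) s) S ∧
            ∀ p ∈ barlowStacking 1 (Real.sqrt (2 / 3)) s, ∀ q ∈ barlowStacking 1 (Real.sqrt (2 / 3)) s,
              (dist p q = 1 ↔ (0 < dist (Φ p) (Φ q) ∧ dist (Φ p) (Φ q) < 6 / 5))) →
      ∀ᵐ μ ∂P, ∃ S : Set (EuclideanSpace ℝ (Fin 3)),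
        μ = (Measure.count : Measure (EuclideanSpace ℝ (Fin 3))).restrict S ∧
        ∀ x ∈ S, ∀ y ∈ S, 0 < dist x y → dist x y < 6 / 5 →
          (93 / 100 : ℝ) ≤ dist x y ∧ dist x y ≤ 101 / 100)
    (h₂ :
    ∀ δ : ℝ, 0 < δ → ∀ P : Measure (Measure (EuclideanSpace ℝ (Fin 3))), IsProbabilityMeasure P →
      (∀ᵐ μ ∂P, IsRootedHardCore δ μ) → IsPointStationaryLaw P →
      (∫ μ, (∫ y, lennardJones ‖y‖ ∂μ) / 2 ∂P) ≤
        (⨅ Q : PeriodicConfiguration 3, Q.energyPerParticle lennardJones) →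
      (∀ᵐ μ ∂P, ∃ S : Set (EuclideanSpace ℝ (Fin 3)),
        μ = (Measure.count : Measure (EuclideanSpace ℝ (Fin 3))).restrict S ∧
        (∀ y ∈ S, SetGood S y) ∧
        ∃ s : ℤ → ℤ, IsHaggSeq s ∧
          ∃ Φ : EuclideanSpace ℝ (Fin 3) → EuclideanSpace ℝ (Fin 3),
            Set.BijOn Φ (barlowStacking 1 (Real.sqrt (2 / 3)) s) S ∧
            ∀ p ∈ barlowStacking 1 (Real.sqrt (2 / 3)) s, ∀ q ∈ barlowStacking 1 (Real.sqrt (2 / 3)) s,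
              (dist p q = 1 ↔ (0 < dist (Φ p) (Φ q) ∧ dist (Φ p) (Φ q) < 6 / 5))) →
      (∀ᵐ μ ∂P, ∃ S : Set (EuclideanSpace ℝ (Fin 3)),
        μ = (Measure.count : Measure (EuclideanSpace ℝ (Fin 3))).restrict S ∧
        ∀ x ∈ S, ∀ y ∈ S, 0 < dist x y → dist x y < 6 / 5 →
          (93 / 100 : ℝ) ≤ dist x y ∧ dist x y ≤ 101 / 100) →
      ∀ᵐ μ ∂P, ∃ S : Set (EuclideanSpace ℝ (Fin 3)),
        μ = (Measure.count : Measure (EuclideanSpace ℝ (Fin 3))).restrict S ∧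
        ∀ x ∈ S, (∃ a : ℝ, 9 / 10 ≤ a ∧ a ≤ 1 ∧ ∃ T : Finset (EuclideanSpace ℝ (Fin 3)),
          (↑T : Set (EuclideanSpace ℝ (Fin 3))) =
            (fun y : EuclideanSpace ℝ (Fin 3) => y - x) ''
              {y : EuclideanSpace ℝ (Fin 3) | y ∈ S ∧ y ≠ x ∧ dist y x ≤ 5 / 4 * a} ∧
          (ShellCloseTo (a / 100) T (Finset.image (fun v : EuclideanSpace ℝ (Fin 3) => a • v) fccKissingPattern) ∨
            ShellCloseTo (a / 100) T (Finset.image (fun v : EuclideanSpace ℝ (Fin 3) => a • v) hcpKissingPattern))))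
    (h₃ : PalmUnimodularRigidity.LayeredLawsSelectHcp) :
    Summit.AtomisticToContinuum.Crystallization.Theses.ReggeStarCoercivity.DefectFreeCrystallizes :=
  Summit.AtomisticToContinuum.Crystallization.Theorems.PalmGoodLaw.RouteBeta.defectFreeCrystallizes_of_chartedFunnelToShells
    (chartedFunnelToShells_of_pinning h₁ h₂) h₃

/-- **The line concludes the crux BY NAME**: the three registered stubs fed into `DefectFreeCrystallizes_of`. -/
theorem defectFreeCrystallizes_skeleton :
    Summit.AtomisticToContinuum.Crystallization.Theses.ReggeStarCoercivity.DefectFreeCrystallizes :=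
  DefectFreeCrystallizes_of stub_bondWindowPinning stub_shapeExactificationPinned stub_layeredLawsSelectHcp

end Summit.AtomisticToContinuum.Crystallization.Cruxes.DefectFreeCrystallizes.ScaleFirst

end
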